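import Mathlib
import Summits.ResolutionOfSingularities.ResolutionOfSingularities.Theorems.WeightedInvariantLocalWeightedDropNCIndependentForms

/-!
# `LocalWeightedDrop`, line `nc-game-transport`, TOT rung R0 (part C): SNC RECOGNITION — a unit times powers of germs vanishing at the
# origin with LINEARLY INDEPENDENT DIFFERENTIALS has normal-crossing support

[OURS · L1 W4.3 · chain w43, engine crux `LocalWeightedDrop` stmt-ResolutionOfSingularities-8899; strategist res-L1-w43-strat-1, line
`nc-game-transport`, rung spec `L/res-L1-w43-strat-1/TOT-RUNGS-SPEC.md` §R0 (R0 → res-D-pv-006; CHAIN v4.10 SEAT TABLE v9 «006 TOT rungs»).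
Objects = the programme's own (`TameFourTupleDrop.GermIsNC`, …SpaceCountDefs); NOT a statement of any manuscript; closes nothing by name.
The common generalisation of part A's `germIsNC_of_smooth_mul_unitMonomial` (one smooth factor transversal to a coordinate monomial) and
part B's `germIsNC_unit_mul_prod_pow_of_linearIndependent` (independent LINEAR forms): the classical fact «transversal smooth hypersurface
germs form a normal crossing», in the count game's currency — the terminal test every TOT rung (R2 arrangements, R1 toric, …) ends with.]

* `prod_pow_extend_eq` — bookkeeping: for an injective `r : ι → Fin n` and `F (r i) = f i`, `∏ₗ F l ^ (extend r e 0) l = ∏ᵢ f i ^ e i`.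
* `exists_coords_extend_of_linearIndependent_differentials` — germs `gᵢ` (`gᵢ(0) = 0`) with linearly independent differentials
  `dgᵢ(0) = (∂gᵢ/∂xⱼ(0))ⱼ` are distinct members `θ (r i) = gᵢ` of a LEGAL coordinate system `θ` (zero constant terms, invertible linear
  part): complete the differentials to an invertible matrix (`exists_matrix_rows_of_linearIndependent`, part B) and fill the remaining
  slots with the corresponding linear forms.
* `germIsNC_unit_mul_prod_pow_of_linearIndependent_differentials` — **SNC RECOGNITION**: `gᵢ(0) = 0`, `{dgᵢ(0)}ᵢ` linearly independent,
  `u(0) ≠ 0` ⇒ `GermIsNC (u · ∏ᵢ gᵢ^{eᵢ})` (by part A's `germIsNC_unit_mul_prod_pow_coords` in the coordinate system `θ`).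
-/

noncomputable section

open Literature.AlgebraicGeometry.Resolution

set_option linter.dupNamespace false -- mandated namespace of this single-conjunct summit

namespace Summit.ResolutionOfSingularities.ResolutionOfSingularities.Theorems

namespace NCTransport

open MvPowerSeries TameFourTupleDrop

variable {k : Type} [Field k]

/-- Bookkeeping: a product of powers over `ι` re-indexed along an injection `r : ι → Fin n`, the exponents extended by `0` off the image. -/
theorem prod_pow_extend_eq {n : ℕ} {ι : Type} [Fintype ι] {R : Type} [CommMonoid R] {r : ι → Fin n} (hr : Function.Injective r)
    (F : Fin n → R) (f : ι → R) (hF : ∀ i, F (r i) = f i) (e : ι → ℕ) :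
    ∏ l, F l ^ Function.extend r e 0 l = ∏ i, f i ^ e i := by
  classical
  rw [← Finset.prod_subset (Finset.subset_univ (Finset.univ.image r)), Finset.prod_image fun i _ j _ h => hr h]
  · exact Finset.prod_congr rfl fun i _ => by rw [hr.extend_apply, hF]
  · intro l _ hl
    rw [Function.extend_apply' _ _ _ (fun ⟨i, hi⟩ => hl (Finset.mem_image.mpr ⟨i, Finset.mem_univ _, hi⟩)), Pi.zero_apply, pow_zero]

/-- COMPLETING TRANSVERSAL GERMS TO A COORDINATE SYSTEM: germs `gᵢ` with `gᵢ(0) = 0` and linearly independent differentials at the origin are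
distinct members of a legal formal coordinate system `θ` (zero constant terms, invertible linear part). -/
theorem exists_coords_extend_of_linearIndependent_differentials {n : ℕ} {ι : Type} {g : ι → MvPowerSeries (Fin n) k}
    (hg0 : ∀ i, constantCoeff (g i) = 0)
    (hdg : LinearIndependent k (fun i => (fun j => coeff (Finsupp.single j 1) (g i) : Fin n → k))) :
    ∃ (θ : Fin n → MvPowerSeries (Fin n) k) (r : ι → Fin n), (∀ l, constantCoeff (θ l) = 0) ∧
      IsUnit (Matrix.det (Matrix.of fun l j => coeff (Finsupp.single j 1) (θ l))) ∧ Function.Injective r ∧ ∀ i, θ (r i) = g i := by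
  classical
  obtain ⟨M, r, hM, hr, hMr⟩ := exists_matrix_rows_of_linearIndependent hdg
  refine ⟨Function.extend r g (FormalCoordChange.linSubst M), r, fun l => ?_, ?_, hr, fun i => hr.extend_apply _ _ i⟩
  · by_cases hl : ∃ i, r i = l
    · obtain ⟨i, rfl⟩ := hl
      rw [hr.extend_apply]
      exact hg0 i
    · rw [Function.extend_apply' _ _ _ hl]
      exact ConeDichotomy.constantCoeff_linSubst M l
  · have hlin : (Matrix.of fun l j => coeff (Finsupp.single j 1) (Function.extend r g (FormalCoordChange.linSubst M) l)) = M := by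
      ext l j
      rw [Matrix.of_apply]
      by_cases hl : ∃ i, r i = l
      · obtain ⟨i, rfl⟩ := hl
        rw [hr.extend_apply, hMr]
      · rw [Function.extend_apply' _ _ _ hl]
        have h := congr_fun (congr_fun (ConeDichotomy.linMat_linSubst (k := k) M) l) j
        rwa [Matrix.of_apply] at h
    rw [hlin]
    exact hM

/-- **SNC RECOGNITION** (OURS · L1 W4.3, rung R0 part C; the terminal test of the TOT rungs): germs `gᵢ` with `gᵢ(0) = 0` whose differentials
at the origin `dgᵢ(0) = (∂gᵢ/∂xⱼ(0))ⱼ` are LINEARLY INDEPENDENT, a unit `u` (`u(0) ≠ 0`) and any exponents `eᵢ` give a germ with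
normal-crossing support: `GermIsNC (u · ∏ᵢ gᵢ^{eᵢ})` — transversal smooth hypersurface germs form a normal crossing. -/
theorem germIsNC_unit_mul_prod_pow_of_linearIndependent_differentials {n : ℕ} {ι : Type} [Fintype ι]
    {g : ι → MvPowerSeries (Fin n) k} (hg0 : ∀ i, constantCoeff (g i) = 0)
    (hdg : LinearIndependent k (fun i => (fun j => coeff (Finsupp.single j 1) (g i) : Fin n → k)))
    {u : MvPowerSeries (Fin n) k} (hu : constantCoeff u ≠ 0) (e : ι → ℕ) :
    GermIsNC (u * ∏ i, g i ^ e i) := by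
  obtain ⟨θ, r, hθ0, hθdet, hr, hθr⟩ := exists_coords_extend_of_linearIndependent_differentials hg0 hdg
  rw [← prod_pow_extend_eq hr θ g hθr e]
  exact germIsNC_unit_mul_prod_pow_coords hθ0 hθdet hu _

end NCTransport

end Summit.ResolutionOfSingularities.ResolutionOfSingularities.Theorems
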